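import Summits.ResolutionOfSingularities.ResolutionOfSingularities.Theorems.PurelyInseparableDim4AtlasHostStepL
import Summits.ResolutionOfSingularities.ResolutionOfSingularities.Theorems.PurelyInseparableDim4AtlasSurvivalL
import Summits.ResolutionOfSingularities.ResolutionOfSingularities.Theorems.PurelyInseparableDim4AtlasMemberForest
import Summits.ResolutionOfSingularities.ResolutionOfSingularities.Theorems.PurelyInseparableDim4AtlasNodes
import HarnessLib

/-!
# Purely inseparable four-folds: the NODE THEOREM and the ROOT for atlas members WITH LETTERS AND SHEARS — a marked resolution of
# `z^p + F` from a tranche-2 plan (brick S3 (c) v4, tranche 2, bricks A5⁺ / ROOT⁺; cell `res-dim4-pi`)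

[OURS · counted 0] (D-0157 DOOR 2; host item stmt-ResolutionOfSingularities-16155, helper). Nothing here proves resolution of
singularities in dimension ≥ 4 / characteristic `p`. The tranche-2 member datum `MemberDataAL` (DefsFour; memo
`res-dim4-typ-3/S3c-V4-ATLAS-MEMBERS-DESIGN.md` §16, E-V4-4) is a MEMBER SYSTEM in the sense of the generic node theorem
(`exists_isMarkedResolution_of_member_node`, p724734): (ADM) by its clauses and `coe_member_subset_support_of_atlasZL`, (WF) by
`acc_finset_successors_of_forall_acc` for `AEdgeL`, (SURV) = A2⁺ `memberDataAL_survival`, (HOST) = A3⁺ `memberDataAL_host_step` with the leaf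
points turned into `PointData` by `BlockAL`'s (P3). ROOT: the root host of `z^p + F` read through the SHEARED root zigzag (G1) carries
`MemberDataAL` with the single reading `((shearState (shr r₀) s, S, ∅, ∅), ∅)` and no letters; hence a marked order-`p` reduction of
`z^p + F` from any tranche-2 plan `(shr, plan, leaves)` whose blocks hold along `AEdgeL` from the root and which is `AEdgeL`-accessible.

* `memberDataAL_node_step_data` (HOST shape), **`exists_isMarkedResolution_of_atlas_node_L`** (A5⁺), `root_memberDataAL`,
  **`exists_isMarkedResolution_atlas_root_L`** (ROOT⁺: the tranche-2 end-to-end theorem).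

AI-produced formalisation, weaker than expert review. bears_on: LADDER-RESOLUTION:D157-DOOR2 (res-dim4-pi · S3 (c) v4 tranche 2 A5⁺/ROOT⁺).
-/

set_option linter.dupNamespace false -- D-0017: single-problem summit path `Summit.<S>.<S>.…` by design

noncomputable section

open MvPolynomial Finset CategoryTheory AlgebraicGeometry Opposite TopologicalSpace
open AlgebraicGeometry.Scheme.IdealSheafData (ofIdealTop vanishingIdeal)

namespace Summit.ResolutionOfSingularities.ResolutionOfSingularities.Theorems.PIDim4

open Literature.AlgebraicGeometry.Resolution
open Literature.AlgebraicGeometry.Resolution.Hauser2010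
open Literature.AlgebraicGeometry.Resolution.AffinePointBlowup (P A γ coord Wtop ξ)

namespace Equimultiple

section NodesAL

variable {K : Type} [Field K] {p : ℕ} [hp : Fact p.Prime] [CharP K p] [DecidableEq K] [IsAlgClosed K]

/-- **(HOST) for `MemberDataAL`**: the host step A3⁺ in the shape the generic node theorem consumes — children indexed by
(reading, entry), `lt`-smaller reading sets, leaf points with `PointData`. [cite: BierstoneGrigorievMilmanWlodarczyk2011, Def. 3.1.3]
[cite: Hauser2010, §§F–G] -/
theorem memberDataAL_node_step_data [DecidableEq (AReadingL K)] (shr : AReading K → Fin 4 × (Fin 4 → K))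
    (plan : AReadingL K → Finset (Fin 4 × (Fin 4 → K) × Finset (Fin 4)))
    (leaves : AReadingL K → Finset (Fin 4 × (Fin 4 → K))) {X' : Scheme.{0}} [IsLocallyNoetherian X'] (M' : MarkedIdeal X')
    (hmult : M'.mult = p) (c : Closeds X') (R : Finset (AReadingL K)) (h : MemberDataAL p shr plan leaves M' c R) :
    ∃ (ι : Type) (I : Finset ι) (kid : ι → Closeds (blowup (vanishingIdeal c))) (Rk : ι → Finset (AReadingL K)),
      (∀ i ∈ I, MemberDataAL p shr plan leaves ((M'.transform (blowup.π (vanishingIdeal c)) (vanishingIdeal c))) (kid i) (Rk i) ∧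
        (kid i : Set (blowup (vanishingIdeal c))) ⊆ blowup.π (vanishingIdeal c) ⁻¹' (c : Set X') ∧
        (kid i : Set (blowup (vanishingIdeal c))).Nonempty) ∧
      (∀ i ∈ I, ∀ i' ∈ I, i ≠ i' →
        Disjoint (kid i : Set (blowup (vanishingIdeal c))) (kid i' : Set (blowup (vanishingIdeal c)))) ∧
      (∀ i ∈ I, ((Rk i).Nonempty ∧ ∃ r ∈ R, ∀ r' ∈ Rk i, AEdgeL p shr plan r' r) ∧ Rk i ≠ R) ∧
      (∀ w : blowup (vanishingIdeal c), IsClosed ({w} : Set (blowup (vanishingIdeal c))) →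
        blowup.π (vanishingIdeal c) w ∈ (c : Set X') →
        (p : ℕ∞) ≤ idealOrder (M'.transform (blowup.π (vanishingIdeal c)) (vanishingIdeal c)).ideal w →
        (∃ i ∈ I, w ∈ (kid i : Set (blowup (vanishingIdeal c)))) ∨
        ∃ s : State K, PointData p (M'.transform (blowup.π (vanishingIdeal c)) (vanishingIdeal c)) w s) ∧
      {w : blowup (vanishingIdeal c) | IsClosed ({w} : Set (blowup (vanishingIdeal c))) ∧
        blowup.π (vanishingIdeal c) w ∈ (c : Set X') ∧
        (p : ℕ∞) ≤ idealOrder (M'.transform (blowup.π (vanishingIdeal c)) (vanishingIdeal c)).ideal w ∧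
        ∀ i ∈ I, w ∉ (kid i : Set (blowup (vanishingIdeal c)))}.Finite := by
  classical
  have hbasic := h.1
  have hblocks := h.2.2.2.2.2.1
  have hacc := h.2.2.2.2.2.2
  obtain ⟨kid, hkid, hkdisj, hkcover, hkfin⟩ := memberDataAL_host_step M' hmult shr plan leaves c h
  set I : Finset (AReadingL K × (Fin 4 × (Fin 4 → K) × Finset (Fin 4))) := R.biUnion fun r => (plan r).image fun e => (r, e) with hI
  have hmemI : ∀ i, i ∈ I ↔ i.1 ∈ R ∧ i.2 ∈ plan i.1 := by
    rintro ⟨r, e⟩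
    simp only [hI, Finset.mem_biUnion, Finset.mem_image, Prod.mk.injEq]
    constructor
    · rintro ⟨r', hr', e', he', rfl, rfl⟩; exact ⟨hr', he'⟩
    · rintro ⟨hr, he⟩; exact ⟨r, hr, e, he, rfl, rfl⟩
  refine ⟨_, I, fun i => kid i.1 i.2, fun i => insert (mainReadingL p shr i.1 i.2) ((i.1.1.2.1 \ i.2.2.2).image fun l => extraReadingL p shr i.1 i.2 l),
    fun i hi => hkid i.1 ((hmemI i).mp hi).1 i.2 ((hmemI i).mp hi).2, fun i hi i' hi' hne => ?_, fun i hi => ?_,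
    fun w hw hwc hord => ?_, ?_⟩
  · exact hkdisj i.1 ((hmemI i).mp hi).1 i.2 ((hmemI i).mp hi).2 i'.1 ((hmemI i').mp hi').1 i'.2 ((hmemI i').mp hi').2
      (fun h => hne (Prod.ext (Prod.mk.inj h).1 (Prod.mk.inj h).2))
  · obtain ⟨hr, he⟩ := (hmemI i).mp hi
    have hall : ∀ r' ∈ insert (mainReadingL p shr i.1 i.2) ((i.1.1.2.1 \ i.2.2.2).image fun l => extraReadingL p shr i.1 i.2 l),
        AEdgeL p shr plan r' i.1 := by
      intro r' hr'
      rcases Finset.mem_insert.mp hr' with rfl | hr'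
      · exact aedgeL_mainReadingL shr plan i.1 he
      · obtain ⟨l, hl, rfl⟩ := Finset.mem_image.mp hr'
        exact aedgeL_extraReadingL shr plan i.1 he hl
    refine ⟨⟨⟨_, Finset.mem_insert_self _ _⟩, i.1, hr, hall⟩, fun heq => ?_⟩
    have heq' : insert (mainReadingL p shr i.1 i.2) ((i.1.1.2.1 \ i.2.2.2).image fun l => extraReadingL p shr i.1 i.2 l) = R := heq
    exact not_rel_self_of_acc (hacc i.1 hr) (hall i.1 (by rw [heq']; exact hr))
  · rcases hkcover w hw hwc hord with ⟨r, hr, e, he, hwe⟩ | ⟨r, hr, l, hl, hl1, hl2, heq, Y', φ', ψ', _, _, y', hφ', hψ', hMw⟩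
    · exact Or.inl ⟨(r, e), (hmemI (r, e)).mpr ⟨hr, he⟩, hwe⟩
    · right
      obtain ⟨hFr, hcleanr, hSr⟩ := hbasic r hr
      have hP3 := (hblocks r hr r Relation.ReflTransGen.refl).1.2.2.1
      obtain ⟨-, hP3l⟩ := hP3 l hl
      obtain ⟨haccl, hfinl⟩ := hP3l heq
      refine ⟨CentreBlowup.step p r.1.2.1 l.1 l.2 r.1.1, step_F_ne_zero_of_isClean hl1 l.2 r.1.1 hFr hcleanr hSr.2,
        isClean_step r.1.2.1 l.1 l.2 r.1.1, ordAlong_univ_step_of_isEquimultiplePoint' r.1.2.1 l.1 l.2 r.1.1 heq, haccl,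
        fun s' hs' => ?_, Y', φ', ψ', inferInstance, inferInstance, y', hφ', hψ', hMw⟩
      exact finite_closedOver_model_of_finite_pairs s'
        (ordAlong_univ_of_reflTransGen_edge (ordAlong_univ_step_of_isEquimultiplePoint' r.1.2.1 l.1 l.2 r.1.1 heq) hs')
        (hfinl s' hs')
  · exact hkfin.subset fun w ⟨hw, hwx, hord, hout⟩ =>
      ⟨hw, hwx, hord, fun r hr e he => hout (r, e) ((hmemI (r, e)).mpr ⟨hr, he⟩)⟩

/-- **THE NODE THEOREM FOR ATLAS MEMBERS WITH LETTERS AND SHEARS (A5⁺)** — an instance of the generic node theorem.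
[cite: BierstoneGrigorievMilmanWlodarczyk2011, Def. 3.1.3] [cite: Hauser2010, §§F–G] -/
theorem exists_isMarkedResolution_of_atlas_node_L {X₀ : Scheme.{0}} [IsLocallyNoetherian X₀] [JacobsonSpace X₀]
    [DecidableEq (AReadingL K)] (M₀ : MarkedIdeal X₀) (hE : HasSNC M₀.boundary) (hmult : M₀.mult = p)
    (shr : AReading K → Fin 4 × (Fin 4 → K)) (plan : AReadingL K → Finset (Fin 4 × (Fin 4 → K) × Finset (Fin 4)))
    (leaves : AReadingL K → Finset (Fin 4 × (Fin 4 → K)))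
    (pts : Finset X₀) (st : X₀ → State K) (hclosed : ∀ x ∈ pts, IsClosed ({x} : Set X₀))
    (hdata : ∀ x ∈ pts, PointData p M₀ x (st x))
    (cms : Finset (Closeds X₀)) (Rd : Closeds X₀ → Finset (AReadingL K))
    (hcdata : ∀ c ∈ cms, MemberDataAL p shr plan leaves M₀ c (Rd c))
    (hdisj₁ : ∀ c ∈ cms, ∀ c' ∈ cms, c ≠ c' → Disjoint (c : Set X₀) (c' : Set X₀))
    (hdisj₂ : ∀ x ∈ pts, ∀ c ∈ cms, x ∉ (c : Set X₀))
    (hcover : ∀ z : X₀, IsClosed ({z} : Set X₀) → (p : ℕ∞) ≤ idealOrder M₀.ideal z → z ∈ pts ∨ ∃ c ∈ cms, z ∈ (c : Set X₀)) :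
    ∃ (X'' : Scheme.{0}) (ρ' : X'' ⟶ X₀) (M'' : MarkedIdeal X''), IsMarkedResolution M₀ ρ' M'' := by
  classical
  let MD : ∀ ⦃X' : Scheme.{0}⦄, MarkedIdeal X' → Closeds X' → Finset (AReadingL K) → Prop :=
    fun ⦃X'⦄ M' c R => MemberDataAL p shr plan leaves M' c R
  let lt : Finset (AReadingL K) → Finset (AReadingL K) → Prop :=
    fun R' R => (R'.Nonempty ∧ ∃ r ∈ R, ∀ r' ∈ R', AEdgeL p shr plan r' r) ∧ R' ≠ R
  have hadm : ∀ ⦃X' : Scheme.{0}⦄ [IsLocallyNoetherian X'] (M' : MarkedIdeal X') (c : Closeds X') (R : Finset (AReadingL K)),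
      M'.mult = p → MD M' c R →
      Scheme.IsRegular (vanishingIdeal c).subscheme ∧ HasSNCWith M'.boundary (vanishingIdeal c) ∧ (c : Set X') ⊆ M'.support := by
    intro X' _ M' c R hm h
    exact ⟨h.2.2.1, h.2.2.2.1, coe_member_subset_support_of_atlasZL M' hm c R h.2.2.2.2.1 fun r hr => (h.1 r hr).2.2.2⟩
  have hwf : ∀ ⦃X' : Scheme.{0}⦄ (M' : MarkedIdeal X') (c : Closeds X') (R : Finset (AReadingL K)), MD M' c R → Acc lt R := by
    intro X' M' c R h
    exact acc_finset_successors_of_forall_acc _ R h.2.2.2.2.2.2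
  have hsurv : ∀ ⦃X' W : Scheme.{0}⦄ [IsLocallyNoetherian X'] [IsLocallyNoetherian W] {π : W ⟶ X'} {Ce : X'.IdealSheafData},
      IsBlowup π Ce → ∀ M' : MarkedIdeal X', M'.mult = p → HasSNCWith M'.boundary Ce →
      ∀ (c : Closeds X') (R : Finset (AReadingL K)), Disjoint (c : Set X') (Ce.support : Set X') → MD M' c R →
      MD (M'.transform π Ce) (c.preimage π.continuous) R := by
    intro X' W _ _ π Ce hπ M' hm hsncC c R hdisj h
    exact memberDataAL_survival hπ M' hm hsncC shr plan leaves c hdisj h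
  have hhost : ∀ ⦃X' : Scheme.{0}⦄ [IsLocallyNoetherian X'] (M' : MarkedIdeal X'), M'.mult = p →
      ∀ (c : Closeds X') (R : Finset (AReadingL K)), MD M' c R →
      ∃ (ι : Type) (I : Finset ι) (kid : ι → Closeds (blowup (vanishingIdeal c))) (Rk : ι → Finset (AReadingL K)),
        (∀ i ∈ I, MD ((M'.transform (blowup.π (vanishingIdeal c)) (vanishingIdeal c))) (kid i) (Rk i) ∧
          (kid i : Set (blowup (vanishingIdeal c))) ⊆ blowup.π (vanishingIdeal c) ⁻¹' (c : Set X') ∧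
          (kid i : Set (blowup (vanishingIdeal c))).Nonempty) ∧
        (∀ i ∈ I, ∀ i' ∈ I, i ≠ i' →
          Disjoint (kid i : Set (blowup (vanishingIdeal c))) (kid i' : Set (blowup (vanishingIdeal c)))) ∧
        (∀ i ∈ I, lt (Rk i) R) ∧
        (∀ w : blowup (vanishingIdeal c), IsClosed ({w} : Set (blowup (vanishingIdeal c))) →
          blowup.π (vanishingIdeal c) w ∈ (c : Set X') →
          (p : ℕ∞) ≤ idealOrder (M'.transform (blowup.π (vanishingIdeal c)) (vanishingIdeal c)).ideal w →
          (∃ i ∈ I, w ∈ (kid i : Set (blowup (vanishingIdeal c)))) ∨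
          ∃ s : State K, PointData p (M'.transform (blowup.π (vanishingIdeal c)) (vanishingIdeal c)) w s) ∧
        {w : blowup (vanishingIdeal c) | IsClosed ({w} : Set (blowup (vanishingIdeal c))) ∧
          blowup.π (vanishingIdeal c) w ∈ (c : Set X') ∧
          (p : ℕ∞) ≤ idealOrder (M'.transform (blowup.π (vanishingIdeal c)) (vanishingIdeal c)).ideal w ∧
          ∀ i ∈ I, w ∉ (kid i : Set (blowup (vanishingIdeal c)))}.Finite := by
    intro X' _ M' hm c R h
    exact memberDataAL_node_step_data shr plan leaves M' hm c R h
  exact exists_isMarkedResolution_of_member_node MD lt (fun R hR => hR.2 rfl) hadm hwf hsurv hhost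
    M₀ hE hmult pts st hclosed hdata cms Rd hcdata hdisj₁ hdisj₂ hcover

end NodesAL

section RootAL

variable {K : Type} [Field K] {p : ℕ} [hp : Fact p.Prime] [CharP K p] [DecidableEq K]

/-- **The SHEARED root host as a tranche-2 atlas member with one reading and no letters.** [cite: BierstoneGrigorievMilmanWlodarczyk2011,
Def. 3.1.3] [cite: Hauser2010, §G] -/
theorem root_memberDataAL [IsAlgClosed K] [DecidableEq (AReadingL K)] (F : MvPolynomial (Fin 4) K) (hF : F ≠ 0)
    (hclean : Literature.Barriers.ResolutionOfSingularities.HauserPerlega.IsClean p F) (shr : AReading K → Fin 4 × (Fin 4 → K))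
    (plan : AReadingL K → Finset (Fin 4 × (Fin 4 → K) × Finset (Fin 4)))
    (leaves : AReadingL K → Finset (Fin 4 × (Fin 4 → K))) (b : Fin 4 → K) (S : Finset (Fin 4)) (s : State K)
    (hs : s = ⟨deletePthPowers p (PointBlowup.translate b F), 0, ∅⟩) (hS : IsPermissibleCentre p S s.F)
    (hOK : ShearOK S (∅ : Finset (Fin 4 × K)) (shr (s, S, (∅ : Finset (Fin 4 × K)), (∅ : Finset (Fin 4)))))
    (hblocks : ∀ q : AReadingL K, Relation.ReflTransGen (fun a e : AReadingL K => AEdgeL p shr plan e a)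
      (shearReading p shr (s, S, (∅ : Finset (Fin 4 × K)), (∅ : Finset (Fin 4))), (∅ : Finset (Fin 4 × K))) q → BlockAL p shr plan leaves q)
    (hacc : Acc (fun q' q : AReadingL K => AEdgeL p shr plan q' q)
      (shearReading p shr (s, S, (∅ : Finset (Fin 4 × K)), (∅ : Finset (Fin 4))), (∅ : Finset (Fin 4 × K)))) :
    ∃ c₀ : Closeds (P 4 K),
      MemberDataAL p shr plan leaves (⟨hypSheaf p F, [], p⟩ : MarkedIdeal (P 4 K)) c₀
        ({(shearReading p shr (s, S, (∅ : Finset (Fin 4 × K)), (∅ : Finset (Fin 4))), (∅ : Finset (Fin 4 × K)))} : Finset (AReadingL K)) ∧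
      (∀ z : P 4 K, z ∈ (c₀ : Set (P 4 K)) → ∀ i ∈ S, (X i.succ - C (b i) : A 4 K) ∈ z.asIdeal) ∧
      (∀ z : P 4 K, IsClosed ({z} : Set (P 4 K)) → (1 : ℕ∞) ≤ idealOrder (hypSheaf p F) z →
        (∀ i ∈ S, (X i.succ - C (b i) : A 4 K) ∈ z.asIdeal) → z ∈ (c₀ : Set (P 4 K))) := by
  classical
  set r₀ : AReading K := (s, S, (∅ : Finset (Fin 4 × K)), (∅ : Finset (Fin 4))) with hr₀
  set r₁ : AReadingL K := (shearReading p shr r₀, (∅ : Finset (Fin 4 × K))) with hr₁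
  have hS' : IsPermissibleCentre p S (deletePthPowers p (PointBlowup.translate b F)) := by rw [hs] at hS; exact hS
  obtain ⟨c₀, hreg, hsnc, ⟨Y, φ, ψ, hφ, hψ, hM, hZ, hcφ, hsee⟩, hin, hall⟩ := root_member_package (p := p) F b hS'
  have hF₀ : s.F ≠ 0 := by rw [hs]; exact deletePthPowers_translate_ne_zero hF hclean b
  have hclean₀ : Literature.Barriers.ResolutionOfSingularities.HauserPerlega.IsClean p s.F := by
    rw [hs]; exact isClean_deletePthPowers _
  have hM₀ : (⟨hypSheaf p F, [], p⟩ : MarkedIdeal (P 4 K)).ideal.comap φ = (hypSheaf p s.F).comap ψ := by rw [hs]; exact hM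
  -- G1 at the root zigzag with the shear of record
  obtain ⟨τ, hτF, h1, h2, h3, h4⟩ := exists_algEquiv_shearFun (K := K) S (shr r₀).1 (shr r₀).2
  obtain ⟨hτ, hτ', -, -⟩ := shearFun_fixes_of_shearOK hOK (fun ic hic => absurd hic (Finset.notMem_empty ic)) τ h1 h2 h3 h4
  obtain ⟨ψ', hψ', hM', hZ', hsee', -, hown'⟩ :=
    zigzag_shear_reading (p := p) φ ψ _ _ hM₀ hZ hsee (le_trans (by exact_mod_cast hp.out.one_lt.le) hS.2) τ hτ hτ'
  obtain ⟨hF₁, hclean₁, hperm₁⟩ :=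
    shearState_basics (p := p) hOK (fun ic hic => absurd hic (Finset.notMem_empty ic)) s hF₀ hclean₀ hS
  have hstate : r₁.1.1 = shearState p S (shr r₀) s := rfl
  have hMs : (⟨hypSheaf p F, [], p⟩ : MarkedIdeal (P 4 K)).ideal.comap φ = (hypSheaf p r₁.1.1.F).comap ψ' := by
    rw [hstate]
    have h : (shearState p S (shr r₀) s).F = deletePthPowers p (τ s.F) := by rw [hτF]; rfl
    rw [h]; exact hM'
  have himg : φ '' (ψ ⁻¹' (AffineCoordBlowup.CΛ 4 K (insert 0 (Fin.succ '' (S : Set (Fin 4)))) : Set (P 4 K))) = (c₀ : Set (P 4 K)) :=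
    coe_member_eq_image φ ψ c₀ hZ hcφ
  have hpre' : ψ' ⁻¹' (AffineCoordBlowup.CΛ 4 K (insert 0 (Fin.succ '' (S : Set (Fin 4)))) : Set (P 4 K)) =
      ψ ⁻¹' (AffineCoordBlowup.CΛ 4 K (insert 0 (Fin.succ '' (S : Set (Fin 4)))) : Set (P 4 K)) := by
    have h := hown' ∅ (fun iv hiv => absurd hiv (Finset.notMem_empty iv))
    rw [ownedSetZ_empty] at h
    exact h
  have himg' : φ '' (ψ' ⁻¹' (AffineCoordBlowup.CΛ 4 K (insert 0 (Fin.succ '' (S : Set (Fin 4)))) : Set (P 4 K))) = (c₀ : Set (P 4 K)) := by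
    rw [hpre', himg]
  have hr : ∀ r : ↥({r₁} : Finset (AReadingL K)), (r : AReadingL K) = r₁ := fun r => Finset.mem_singleton.mp r.2
  have hown : ∀ v : Fin 4 → K, ownedSetZ S ((∅ : Finset (Fin 4)).image fun m => (m, v m)) =
      (AffineCoordBlowup.CΛ 4 K (insert 0 (Fin.succ '' (S : Set (Fin 4)))) : Set (P 4 K)) := fun v => by
    rw [Finset.image_empty]; exact ownedSetZ_empty S
  haveI := hψ'
  refine ⟨c₀, ⟨fun r hr' => ?_, fun r hr' => ?_, hreg, hsnc, ⟨fun _ => Y, fun _ => φ, fun _ => ψ', fun r => ?_, ?_, ?_⟩,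
    fun r hr' q hq => ?_, fun r hr' => ?_⟩, hin, hall⟩
  · rw [Finset.mem_singleton.mp hr']; exact ⟨hF₁, hclean₁, hperm₁⟩
  · rw [Finset.mem_singleton.mp hr']
    exact ⟨fun iv hiv => absurd hiv (Finset.notMem_empty iv), fun m hm => absurd hm (Finset.notMem_empty m)⟩
  · rw [hr r]
    refine ⟨hφ, hψ', hMs, hZ', hsee', fun v => ?_, fun _ => 0, fun _ => 0, fun D hD => absurd hD List.not_mem_nil,
      fun D₁ hD₁ => absurd hD₁ List.not_mem_nil⟩
    change IsClosed (φ '' (ψ' ⁻¹' ownedSetZ S ((∅ : Finset (Fin 4)).image fun m => (m, v m))))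
    rw [hown v, himg']
    exact c₀.isClosed
  · intro x hx
    refine Set.mem_iUnion.mpr ⟨⟨_, Finset.mem_singleton_self _⟩, ?_⟩
    change x ∈ φ '' (ψ' ⁻¹' ownedSetZ S (∅ : Finset (Fin 4 × K)))
    rw [ownedSetZ_empty, himg']
    exact hx
  · intro r r' hne
    exact absurd (Subtype.ext ((hr r).trans (hr r').symm)) hne
  · rw [Finset.mem_singleton.mp hr'] at hq; exact hblocks q hq
  · rw [Finset.mem_singleton.mp hr']; exact hacc

/-- **A MARKED RESOLUTION OF `z^p + F` FROM A TRANCHE-2 PLAN (letters + shears) AT ONE ROOT HOST — the end-to-end theorem of tranche 2.**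
`F ≠ 0` clean; root point `b`, centre `S` permissible for `clean(F(x + b))`; tables `shr` (shear of record, admissible at the root),
`plan`, `leaves` with `BlockAL` along `AEdgeL` from the sheared root reading and `AEdgeL`-accessibility; every closed point of order `≥ p`
on `x_S = b_S` ⇒ a marked resolution of `(𝔸⁵, (z^p + F), ∅, p)`. [cite: BierstoneGrigorievMilmanWlodarczyk2011, Def. 3.1.3; Thm. 1.1
(char. 0 model)] [cite: Hauser2010, §§F–G] -/
theorem exists_isMarkedResolution_atlas_root_L [IsAlgClosed K] [DecidableEq (AReadingL K)] (F : MvPolynomial (Fin 4) K)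
    (hF : F ≠ 0) (hclean : Literature.Barriers.ResolutionOfSingularities.HauserPerlega.IsClean p F)
    (shr : AReading K → Fin 4 × (Fin 4 → K)) (plan : AReadingL K → Finset (Fin 4 × (Fin 4 → K) × Finset (Fin 4)))
    (leaves : AReadingL K → Finset (Fin 4 × (Fin 4 → K))) (b : Fin 4 → K) (S : Finset (Fin 4)) (s : State K)
    (hs : s = ⟨deletePthPowers p (PointBlowup.translate b F), 0, ∅⟩) (hS : IsPermissibleCentre p S s.F)
    (hOK : ShearOK S (∅ : Finset (Fin 4 × K)) (shr (s, S, (∅ : Finset (Fin 4 × K)), (∅ : Finset (Fin 4)))))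
    (hblocks : ∀ q : AReadingL K, Relation.ReflTransGen (fun a e : AReadingL K => AEdgeL p shr plan e a)
      (shearReading p shr (s, S, (∅ : Finset (Fin 4 × K)), (∅ : Finset (Fin 4))), (∅ : Finset (Fin 4 × K))) q → BlockAL p shr plan leaves q)
    (hacc : Acc (fun q' q : AReadingL K => AEdgeL p shr plan q' q)
      (shearReading p shr (s, S, (∅ : Finset (Fin 4 × K)), (∅ : Finset (Fin 4))), (∅ : Finset (Fin 4 × K))))
    (hcover : ∀ z : P 4 K, IsClosed ({z} : Set (P 4 K)) → (p : ℕ∞) ≤ idealOrder (hypSheaf p F) z →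
      ∀ i ∈ S, (X i.succ - C (b i) : A 4 K) ∈ z.asIdeal) :
    ∃ (X' : Scheme.{0}) (ρ : X' ⟶ P 4 K) (M' : MarkedIdeal X'),
      IsMarkedResolution (⟨hypSheaf p F, [], p⟩ : MarkedIdeal (P 4 K)) ρ M' := by
  classical
  set M₀ : MarkedIdeal (P 4 K) := ⟨hypSheaf p F, [], p⟩ with hM₀
  have hE₀ : HasSNC M₀.boundary :=
    hasSNC_nil_of_isRegular (Literature.AlgebraicGeometry.Hironaka2017.Lib.AffinePointBlowupLSB.isRegular_Z 4 K)
  obtain ⟨c₀, hdata, -, hall⟩ := root_memberDataAL (p := p) F hF hclean shr plan leaves b S s hs hS hOK hblocks hacc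
  refine exists_isMarkedResolution_of_atlas_node_L M₀ hE₀ rfl shr plan leaves ∅ (fun _ => s)
    (fun x hx => absurd hx (Finset.notMem_empty x)) (fun x hx => absurd hx (Finset.notMem_empty x)) {c₀}
    (fun _ => {(shearReading p shr (s, S, (∅ : Finset (Fin 4 × K)), (∅ : Finset (Fin 4))), (∅ : Finset (Fin 4 × K)))})
    (fun c hc => by rw [Finset.mem_singleton.mp hc]; exact hdata)
    (fun c hc c' hc' hcc => absurd ((Finset.mem_singleton.mp hc).trans (Finset.mem_singleton.mp hc').symm) hcc)
    (fun x hx => absurd hx (Finset.notMem_empty x)) fun z hz hzo => Or.inr ⟨c₀, Finset.mem_singleton_self _, ?_⟩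
  exact hall z hz (le_trans (by exact_mod_cast hp.out.one_lt.le) hzo) (hcover z hz hzo)

end RootAL

end Equimultiple

end Summit.ResolutionOfSingularities.ResolutionOfSingularities.Theorems.PIDim4

end
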